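import Literature.Analysis.PDE.LoewnerNirenbergFacts
import HarnessLib

/-!
# Loewner–Nirenberg theory: the half-space fact F5, proved

This file DISCHARGES the named fact `Literature.Analysis.PDE.LoewnerNirenberg.halfSpace_unique`
(F5 of `LoewnerNirenbergFacts.lean`; Duncan–Nguyen 2025, Cor. 1.4, "previously observed in
[HS20]" = Han–Shen 2020): for `n ≥ 3` and a unit vector `ν`, on the open half-space
`H = H(p,ν) = {x | 0 < ⟪x - p, ν⟫}` the profile `⟪x - p, ν⟫^{-(n-2)/2}` (the conformal factor of
the hyperbolic metric of `H`) is a positive solution of `Δu = ¼n(n-2)u^{(n+2)/(n-2)}` tending to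
`+∞` at every point of `∂H`, and it is the ONLY positive classical solution with this boundary
behaviour — no assumption at infinity ("we will not make any assumptions on the behaviour of `w`
at infinity", Duncan–Nguyen 2025, §1 after (26')).

## The printed argument and how it is formalised

Duncan–Nguyen prove the classification for the fully nonlinear problem (15) by moving spheres;
for the semilinear equation (303) the two-sided bound that pins `u` down is elementary and is the
one of their §2.2–2.3 (Lemma 2.6, "we use the hyperbolic metric on a sequence of larger and
larger balls as lower barriers"; Lemma 2.5/2.7, barriers "centred in the lower half space"),
combined with the classical comparison principle for `Δu = f(u)`, `f` increasing (their
Prop. 2.3/2.4 in the viscosity setting; Han–Shen 2020, remark after Thm. 2.3, for cones):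

1. `isLargeSolution_halfSpaceProfile` — the profile solves the equation (`Δ g(⟪ν,·⟫) = g''`,
   `laplacian_comp_inner`, with `g(t) = t^{-k}`, `k = (n-2)/2`, `k(k+1) = ¼n(n-2)`), is positive,
   and blows up at `∂H ⊆ {⟪x - p, ν⟫ = 0}`.
2. `IsSolution.le_of_isCompact_superlevel` — COMPARISON: two classical solutions `v`, `w` on an
   open `Ω` with all superlevel sets `{x ∈ Ω | s ≤ v - w}`, `s > 0`, compact satisfy `v ≤ w`
   (at a positive interior maximum `x₀` of `v - w`, `Δ(v - w)(x₀) ≤ 0`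
   (`laplacian_nonpos_of_isLocalMax` of the facts file) but
   `Δ(v-w)(x₀) = f(v(x₀)) - f(w(x₀)) > 0`, `f` strictly increasing on `[0,∞)` for `n ≥ 3`).
   The compactness is supplied by `isClosed_superlevel_of_tendsto_atBot` (`v - w → -∞` at `∂Ω`).
3. UPPER BARRIER (Lemma 2.6): `IsSolution.le_ballProfile` of the facts file — if `B̄(c,R) ⊆ Ω`
   then `u ≤ (2R/(R² - |x-c|²))^k` on `B(c,R)`.
4. `IsLargeSolution.exteriorProfile_le` — LOWER BARRIER (the exterior hyperbolic profile of a
   ball `B(c,R)` with `cl Ω ∩ B̄(c,R) = ∅`, i.e. centred in the lower half-space):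
   `(2R/(|x-c|² - R²))^k ≤ u` on `Ω` (`u` blows up on `∂Ω`, the exterior profile does not, and it
   tends to `0` at infinity, `tendsto_exteriorProfile_cobounded`, so superlevel sets are bounded).
5. `IsLargeSolution.eqOn_halfSpaceProfile` — for `x ∈ H` with `t = ⟪x - p, ν⟫`, balls
   `B(x + (R-a)ν, R) ⋐ H` (`0 < a < t < R`) give `u(x) ≤ (2R/(a(2R-a)))^k`, exterior balls
   `B(x - (a+R)ν, R)` (`a > t`) give `u(x) ≥ (2R/(a(2R+a)))^k`; `R → ∞` (`tendsto_barrier_atTop`)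
   gives `a^{-k}` on both sides, and `a → t` gives `u(x) = t^{-k}`.

Then `halfSpace_unique_holds : halfSpace_unique`.  Everything is proved; no named fact and no
`sorry` is introduced.

## References

* J. A. J. Duncan, L. Nguyen, *The fully nonlinear Loewner–Nirenberg problem: Liouville theorems
  and counterexamples to local boundary estimates*, arXiv:2507.16383 (2025): (303) (p. 3),
  Cor. 1.4 (p. 5), §2.2–2.3, Lemmas 2.5–2.7 (pp. 8–10). [DuncanNguyen2025]
* Q. Han, W. Shen, *The Loewner–Nirenberg problem in singular domains*, J. Funct. Anal. 279
  (2020) 108604, arXiv:1511.01146: (2.1)–(2.2), Thm. 2.3 and the uniqueness remark following its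
  proof. [HanShen2020]
-/

noncomputable section

open Set Filter Metric Module TopologicalSpace Bornology InnerProductSpace
open scoped Laplacian Topology ContDiff RealInnerProductSpace

namespace Literature.Analysis.PDE

namespace LoewnerNirenberg

variable {E : Type*} [NormedAddCommGroup E] [InnerProductSpace ℝ E] [FiniteDimensional ℝ E]

/-! ### The Laplacian of a function of one linear coordinate -/

omit [FiniteDimensional ℝ E] in
/-- First derivative of `w ↦ g ⟪ν, w⟫`: `D(g ∘ ⟪ν,·⟫)(z) = g'(⟪ν,z⟫) ⟪ν, ·⟫`. [folklore] -/
theorem hasFDerivAt_comp_inner {g : ℝ → ℝ} {g₁ : ℝ} (ν : E) {z : E}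
    (hg : HasDerivAt g g₁ ⟪ν, z⟫_ℝ) :
    HasFDerivAt (fun w : E => g ⟪ν, w⟫_ℝ) (g₁ • (innerSL ℝ ν : E →L[ℝ] ℝ)) z := by
  have h := hg.comp_hasFDerivAt z (innerSL ℝ ν : E →L[ℝ] ℝ).hasFDerivAt
  exact h

omit [FiniteDimensional ℝ E] in
/-- Second derivative of `w ↦ g ⟪ν, w⟫`: with `g' = g₁` on an open set of values containing
`⟪ν, z⟫` and `g₁'(⟪ν,z⟫) = g₂`, the derivative `w ↦ g₁(⟪ν,w⟫) ⟪ν,·⟫` has derivative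
`h ↦ g₂ ⟪ν,h⟫ ⟪ν,·⟫` at `z`. [folklore] -/
theorem hasFDerivAt_fderiv_comp_inner {g g₁ : ℝ → ℝ} {g₂ : ℝ} {U : Set ℝ} (hU : IsOpen U)
    (hg : ∀ σ ∈ U, HasDerivAt g (g₁ σ) σ) (ν : E) {z : E} (hz : ⟪ν, z⟫_ℝ ∈ U)
    (hg₁ : HasDerivAt g₁ g₂ ⟪ν, z⟫_ℝ) :
    HasFDerivAt (fderiv ℝ (fun w : E => g ⟪ν, w⟫_ℝ))
      ((g₂ • (innerSL ℝ ν : E →L[ℝ] ℝ)).smulRight (innerSL ℝ ν : E →L[ℝ] ℝ)) z := by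
  have hV : {w : E | ⟪ν, w⟫_ℝ ∈ U} ∈ 𝓝 z :=
    (hU.preimage (innerSL ℝ ν : E →L[ℝ] ℝ).continuous).mem_nhds hz
  have heq : (fun w : E => g₁ ⟪ν, w⟫_ℝ • (innerSL ℝ ν : E →L[ℝ] ℝ)) =ᶠ[𝓝 z]
      fderiv ℝ (fun w : E => g ⟪ν, w⟫_ℝ) := by
    filter_upwards [hV] with w hw
    exact ((hasFDerivAt_comp_inner ν (hg _ hw)).fderiv).symm
  refine HasFDerivAt.congr_of_eventuallyEq ?_ heq.symm
  exact (hasFDerivAt_comp_inner (g := g₁) ν hg₁).smul_const (innerSL ℝ ν : E →L[ℝ] ℝ)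

/-- **Laplacian of a function of one linear coordinate**: `Δ(g(⟪ν,·⟫))(z) = g''(⟪ν,z⟫) ‖ν‖²`
(the Hessian is `g'' ⟪ν,·⟫ ⊗ ⟪ν,·⟫`, whose trace is `g'' Σᵢ ⟪ν,eᵢ⟫² = g'' ‖ν‖²` by Parseval).
[folklore] -/
theorem laplacian_comp_inner {g g₁ : ℝ → ℝ} {g₂ : ℝ} {U : Set ℝ} (hU : IsOpen U)
    (hg : ∀ σ ∈ U, HasDerivAt g (g₁ σ) σ) (ν : E) {z : E} (hz : ⟪ν, z⟫_ℝ ∈ U)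
    (hg₁ : HasDerivAt g₁ g₂ ⟪ν, z⟫_ℝ) :
    (Δ (fun w : E => g ⟪ν, w⟫_ℝ)) z = g₂ * ‖ν‖ ^ 2 := by
  set b := stdOrthonormalBasis ℝ E
  have hD := hasFDerivAt_fderiv_comp_inner hU hg ν hz hg₁
  have h1 : ∀ i, iteratedFDeriv ℝ 2 (fun w : E => g ⟪ν, w⟫_ℝ) z ![b i, b i] =
      g₂ * (⟪ν, b i⟫_ℝ * ⟪ν, b i⟫_ℝ) := fun i => by
    rw [iteratedFDeriv_two_apply, hD.fderiv]
    simp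
    ring
  have h2 : ∑ i, ⟪ν, b i⟫_ℝ * ⟪ν, b i⟫_ℝ = ‖ν‖ ^ 2 := by
    rw [← real_inner_self_eq_norm_sq, ← b.sum_inner_mul_inner ν ν]
    exact Finset.sum_congr rfl fun i _ => by rw [real_inner_comm (b i) ν]
  rw [congrFun (laplacian_eq_iteratedFDeriv_orthonormalBasis (fun w : E => g ⟪ν, w⟫_ℝ) b) z]
  simp_rw [h1]
  rw [← Finset.mul_sum, h2]

/-! ### The half-space profile is a positive large solution -/

omit [FiniteDimensional ℝ E] in
/-- The half-space profile is positive on the half-space. [folklore] -/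
theorem halfSpaceProfile_pos {p ν x : E} (hx : x ∈ halfSpace p ν) : 0 < halfSpaceProfile p ν x :=
  Real.rpow_pos_of_pos hx _

omit [FiniteDimensional ℝ E] in
/-- The half-space profile is smooth on the half-space. [folklore] -/
theorem contDiffOn_halfSpaceProfile (p ν : E) {m : WithTop ℕ∞} :
    ContDiffOn ℝ m (halfSpaceProfile p ν) (halfSpace p ν) := by
  intro x hx
  have h1 : ContDiffAt ℝ m (fun y : E => ⟪y - p, ν⟫_ℝ) x :=
    (contDiffAt_id.sub contDiffAt_const).inner ℝ contDiffAt_const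
  exact (h1.rpow_const_of_ne (ne_of_gt hx)).contDiffWithinAt

/-- **The half-space profile solves the Loewner–Nirenberg equation** on `H(p,ν)` for `‖ν‖ = 1`,
`n ≥ 3`: with `t = ⟪x-p,ν⟫ > 0` and `k = (n-2)/2`, `Δ t^{-k} = k(k+1) t^{-k-2}` and
`¼n(n-2) (t^{-k})^{(n+2)/(n-2)} = k(k+1) t^{-(k+2)}` (Duncan–Nguyen 2025, §1: "`w⁽⁰⁾(x) = xₙ` is
always a solution", in the variable `u = w^{-(n-2)/2}` of (303)).
[cite: DuncanNguyen2025, (303) and Cor. 1.4] -/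
theorem isSolution_halfSpaceProfile (hn : 3 ≤ finrank ℝ E) (p : E) {ν : E} (hν : ‖ν‖ = 1) :
    IsSolution (halfSpace p ν) (halfSpaceProfile p ν) := by
  obtain ⟨k, hk⟩ : ∃ k : ℝ, ((finrank ℝ E : ℝ) - 2) / 2 = k := ⟨_, rfl⟩
  have hk0 : 0 < k := by
    have : (3 : ℝ) ≤ finrank ℝ E := by exact_mod_cast hn
    rw [← hk]
    linarith
  have hprof : halfSpaceProfile p ν = fun x => (fun w : E => ⟪ν, w⟫_ℝ ^ (-k)) (x - p) := by
    funext x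
    simp only [halfSpaceProfile, hk, real_inner_comm ν]
  refine ⟨contDiffOn_halfSpaceProfile p ν, fun x hx => (halfSpaceProfile_pos hx).le,
    fun x hx => ?_⟩
  have ht : 0 < ⟪ν, x - p⟫_ℝ := by
    rw [← real_inner_comm]
    exact hx
  have hg : ∀ σ ∈ Ioi (0 : ℝ), HasDerivAt (fun τ : ℝ => τ ^ (-k)) (-k * σ ^ (-k - 1)) σ :=
    fun σ hσ => Real.hasDerivAt_rpow_const (Or.inl (ne_of_gt hσ))
  have hg₁ : HasDerivAt (fun τ : ℝ => -k * τ ^ (-k - 1))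
      (-k * ((-k - 1) * ⟪ν, x - p⟫_ℝ ^ (-k - 1 - 1))) ⟪ν, x - p⟫_ℝ :=
    (Real.hasDerivAt_rpow_const (Or.inl ht.ne')).const_mul (-k)
  have hΔ : (Δ (halfSpaceProfile p ν)) x =
      -k * ((-k - 1) * ⟪ν, x - p⟫_ℝ ^ (-k - 1 - 1)) * ‖ν‖ ^ 2 := by
    rw [hprof, laplacian_translate_sub (fun w : E => ⟪ν, w⟫_ℝ ^ (-k)) p x]
    exact laplacian_comp_inner isOpen_Ioi hg ν ht hg₁
  have hval : halfSpaceProfile p ν x = ⟪ν, x - p⟫_ℝ ^ (-k) := by rw [hprof]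
  rw [hΔ, hν, hval]
  simp only [nonlinearity, coeff, exponent]
  have hn' : ((finrank ℝ E : ℕ) : ℝ) = 2 * k + 2 := by
    rw [← hk]
    ring
  rw [hn', ← Real.rpow_mul ht.le]
  have he : -k * ((2 * k + 2 + 2) / (2 * k + 2 - 2)) = -k - 1 - 1 := by
    have hk1 : k ≠ 0 := hk0.ne'
    rw [show (2 * k + 2 - 2) = 2 * k by ring, show (2 * k + 2 + 2) = (k + 2) * 2 by ring,
      mul_div_assoc', show -k * ((k + 2) * 2) = (-k - 1 - 1) * (2 * k) by ring,
      mul_div_cancel_right₀ _ (mul_ne_zero two_ne_zero hk1)]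
  rw [he]
  ring

omit [FiniteDimensional ℝ E] in
/-- On the frontier of the half-space the linear coordinate vanishes. [folklore] -/
theorem inner_eq_zero_of_mem_frontier_halfSpace {p ν z : E} (hz : z ∈ frontier (halfSpace p ν)) :
    ⟪z - p, ν⟫_ℝ = 0 := by
  have h := frontier_lt_subset_eq (f := fun _ : E => (0 : ℝ)) (g := fun x : E => ⟪x - p, ν⟫_ℝ)
    continuous_const (by fun_prop) hz
  exact h.symm

omit [FiniteDimensional ℝ E] in
/-- The half-space profile tends to `+∞` at every boundary point (within `H`), `n ≥ 3`.
[folklore] -/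
theorem tendsto_halfSpaceProfile_atTop (hn : 3 ≤ finrank ℝ E) (p ν : E) {z : E}
    (hz : z ∈ frontier (halfSpace p ν)) :
    Tendsto (halfSpaceProfile p ν) (𝓝[halfSpace p ν] z) atTop := by
  have hk : 0 < ((finrank ℝ E : ℝ) - 2) / 2 := by
    have : (3 : ℝ) ≤ finrank ℝ E := by exact_mod_cast hn
    linarith
  have hz0 : ⟪z - p, ν⟫_ℝ = 0 := inner_eq_zero_of_mem_frontier_halfSpace hz
  have hbase : Tendsto (fun x : E => ⟪x - p, ν⟫_ℝ) (𝓝[halfSpace p ν] z) (𝓝[>] 0) := by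
    refine tendsto_nhdsWithin_iff.2 ⟨?_, eventually_mem_nhdsWithin.mono fun x hx => hx⟩
    have hcont : Continuous fun x : E => ⟪x - p, ν⟫_ℝ := by fun_prop
    simpa [hz0] using (hcont.tendsto z).mono_left nhdsWithin_le_nhds
  have hinv : Tendsto (fun x : E => (⟪x - p, ν⟫_ℝ)⁻¹ ^ (((finrank ℝ E : ℝ) - 2) / 2))
      (𝓝[halfSpace p ν] z) atTop :=
    (tendsto_rpow_atTop hk).comp (tendsto_inv_nhdsGT_zero.comp hbase)
  refine hinv.congr' ?_
  filter_upwards [eventually_mem_nhdsWithin] with x hx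
  have hx' : 0 ≤ ⟪x - p, ν⟫_ℝ := le_of_lt hx
  rw [halfSpaceProfile, Real.rpow_neg hx', Real.inv_rpow hx']

/-- **The half-space profile is a positive large solution** of `H(p,ν)`, `‖ν‖ = 1`, `n ≥ 3`.
[cite: DuncanNguyen2025, (303) and Cor. 1.4] -/
theorem isLargeSolution_halfSpaceProfile (hn : 3 ≤ finrank ℝ E) (p : E) {ν : E} (hν : ‖ν‖ = 1) :
    IsLargeSolution (halfSpace p ν) (halfSpaceProfile p ν) where
  toIsSolution := isSolution_halfSpaceProfile hn p hν
  tendsto_atTop := fun _ hz => tendsto_halfSpaceProfile_atTop hn p ν hz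

/-! ### The comparison principle for classical solutions -/

/-- **Superlevel sets of a function tending to `-∞` at the boundary are closed**: if `w` is
continuous on an open `Ω` and `w → -∞` at every point of `∂Ω` (within `Ω`), then
`{x ∈ Ω | s ≤ w x}` is closed in the whole space. [folklore] -/
theorem isClosed_superlevel_of_tendsto_atBot {X : Type*} [TopologicalSpace X] {Ω : Set X}
    (hΩ : IsOpen Ω) {w : X → ℝ} (hw : ContinuousOn w Ω)
    (hb : ∀ z ∈ frontier Ω, Tendsto w (𝓝[Ω] z) atBot) (s : ℝ) :
    IsClosed {x | x ∈ Ω ∧ s ≤ w x} := by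
  set K := {x | x ∈ Ω ∧ s ≤ w x} with hK
  have hKΩ : K ⊆ Ω := fun x hx => hx.1
  refine isClosed_of_closure_subset fun y hy => ?_
  haveI hne : (𝓝[K] y).NeBot := mem_closure_iff_nhdsWithin_neBot.1 hy
  have hev : ∀ᶠ x in 𝓝[K] y, s ≤ w x := eventually_mem_nhdsWithin.mono fun x hx => hx.2
  by_cases hyΩ : y ∈ Ω
  · refine ⟨hyΩ, ?_⟩
    have ht : Tendsto w (𝓝[K] y) (𝓝 (w y)) := (hw y hyΩ).tendsto.mono_left (nhdsWithin_mono _ hKΩ)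
    exact ge_of_tendsto ht hev
  · exfalso
    have hyfr : y ∈ frontier Ω := by
      rw [frontier, hΩ.interior_eq]
      exact ⟨closure_mono hKΩ hy, hyΩ⟩
    have ht : Tendsto w (𝓝[K] y) atBot := (hb y hyfr).mono_left (nhdsWithin_mono _ hKΩ)
    obtain ⟨x, hx1, hx2⟩ := (hev.and (ht.eventually (eventually_lt_atBot s))).exists
    exact absurd hx1 (not_le.2 hx2)

/-- **Comparison principle for classical solutions** (the maximum-principle step of
Duncan–Nguyen 2025, Prop. 2.3/2.4 and Han–Shen 2020, §2, in the classical setting): let `v`, `w`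
be nonnegative `C²` solutions of `Δu = ¼n(n-2)u^{(n+2)/(n-2)}` on an open `Ω`, `n ≥ 3`, such that
every superlevel set `{x ∈ Ω | s ≤ v - w}` with `s > 0` is compact (i.e. `(v - w)⁺` "vanishes on
`∂Ω` and at infinity"). Then `v ≤ w` on `Ω`: at a point `x₀` where `v - w` attains a positive
maximum, `Δ(v-w)(x₀) ≤ 0`, while `Δ(v-w)(x₀) = f(v(x₀)) - f(w(x₀)) > 0` because `f` is strictly
increasing. [cite: DuncanNguyen2025, Prop. 2.3 and Prop. 2.4 (classical case)] -/
theorem IsSolution.le_of_isCompact_superlevel (hn : 3 ≤ finrank ℝ E) {Ω : Set E} (hΩ : IsOpen Ω)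
    {v w : E → ℝ} (hv : IsSolution Ω v) (hw : IsSolution Ω w)
    (hK : ∀ s : ℝ, 0 < s → IsCompact {x | x ∈ Ω ∧ s ≤ v x - w x}) :
    ∀ x ∈ Ω, v x ≤ w x := by
  intro x hx
  by_contra hxle
  have hlt : w x < v x := lt_of_not_ge hxle
  set s : ℝ := v x - w x with hs
  have hs0 : 0 < s := sub_pos.2 hlt
  set K := {y | y ∈ Ω ∧ s ≤ v y - w y} with hKdef
  have hxK : x ∈ K := ⟨hx, le_rfl⟩
  have hcont : ContinuousOn (fun y => v y - w y) K :=
    (hv.contDiffOn.continuousOn.sub hw.contDiffOn.continuousOn).mono fun y hy => hy.1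
  obtain ⟨x₀, hx₀K, hmax⟩ := (hK s hs0).exists_isMaxOn ⟨x, hxK⟩ hcont
  have hx₀Ω : x₀ ∈ Ω := hx₀K.1
  -- `x₀` is an interior local maximum of `v - w`
  have hloc : IsLocalMax (fun y => v y - w y) x₀ := by
    filter_upwards [hΩ.mem_nhds hx₀Ω] with y hy
    by_cases hyK : y ∈ K
    · exact hmax hyK
    · have hlt' : v y - w y < s := by
        by_contra h
        exact hyK ⟨hy, not_lt.1 h⟩
      exact hlt'.le.trans hx₀K.2
  have hvC : ContDiffAt ℝ 2 v x₀ := hv.contDiffOn.contDiffAt (hΩ.mem_nhds hx₀Ω)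
  have hwC : ContDiffAt ℝ 2 w x₀ := hw.contDiffOn.contDiffAt (hΩ.mem_nhds hx₀Ω)
  have hΔ := laplacian_nonpos_of_isLocalMax hloc (hvC.sub hwC)
  have hsub : (Δ (fun y => v y - w y)) x₀ = (Δ v) x₀ - (Δ w) x₀ := hvC.laplacian_sub hwC
  rw [hsub, hv.laplacian_eq hx₀Ω, hw.laplacian_eq hx₀Ω] at hΔ
  have hlt' : w x₀ < v x₀ := by linarith [hx₀K.2]
  have := nonlinearity_lt_nonlinearity hn (hw.nonneg hx₀Ω) hlt'
  linarith

/-! ### Lower barrier: exterior hyperbolic profiles of balls off the closure -/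

omit [FiniteDimensional ℝ E] in
/-- The exterior profile tends to `0` at infinity, `n ≥ 3`. [folklore] -/
theorem tendsto_exteriorProfile_cobounded (hn : 3 ≤ finrank ℝ E) (c : E) (R : ℝ) :
    Tendsto (exteriorProfile c R) (cobounded E) (𝓝 0) := by
  have hk : 0 < ((finrank ℝ E : ℝ) - 2) / 2 := by
    have : (3 : ℝ) ≤ finrank ℝ E := by exact_mod_cast hn
    linarith
  have h1 : Tendsto (fun x : E => ‖x - c‖) (cobounded E) atTop := by
    refine tendsto_atTop_mono (fun x => ?_)
      (tendsto_atTop_add_const_right _ (-‖c‖) tendsto_norm_cobounded_atTop)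
    have := norm_sub_norm_le x c
    linarith
  have h2 : Tendsto (fun x : E => ‖x - c‖ ^ 2 - R ^ 2) (cobounded E) atTop := by
    have := tendsto_atTop_add_const_right _ (-R ^ 2) ((tendsto_pow_atTop two_ne_zero).comp h1)
    exact this.congr fun x => by simp only [Function.comp_apply]; ring
  have h3 : Tendsto (fun x : E => 2 * R / (‖x - c‖ ^ 2 - R ^ 2)) (cobounded E) (𝓝 0) :=
    tendsto_const_nhds.div_atTop h2
  have h4 := h3.rpow_const (p := ((finrank ℝ E : ℝ) - 2) / 2) (Or.inr hk.le)
  rw [Real.zero_rpow hk.ne'] at h4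
  exact h4

omit [FiniteDimensional ℝ E] in
/-- The positive superlevel sets of the exterior profile are bounded, `n ≥ 3`. [folklore] -/
theorem isBounded_superlevel_exteriorProfile (hn : 3 ≤ finrank ℝ E) (c : E) (R : ℝ) {s : ℝ}
    (hs : 0 < s) : IsBounded {x : E | s ≤ exteriorProfile c R x} := by
  have h := (tendsto_exteriorProfile_cobounded hn c R).eventually (gt_mem_nhds hs)
  rw [isBounded_def]
  refine Filter.mem_of_superset h fun x hx => ?_
  simpa [not_le] using hx

/-- **Lower barrier by exterior hyperbolic profiles** (the semilinear counterpart of the barriers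
"on annuli centred in the lower half space" of Duncan–Nguyen 2025, Lemma 2.5/2.7; the exterior
profile is Han–Shen 2020, (2.2)): if `u` solves the equation on an open `Ω` and tends to `+∞` at
every point of `∂Ω`, and the closed ball `B̄(c,R)`, `R > 0`, misses the closure of `Ω`, then
`(2R/(|x-c|² - R²))^{(n-2)/2} ≤ u` on `Ω`, `n ≥ 3` — the exterior profile is continuous up to `∂Ω`
where `u = +∞`, and tends to `0` at infinity where `u ≥ 0`.
[cite: DuncanNguyen2025, Lemma 2.5 and Lemma 2.7 (proofs)] -/
theorem IsLargeSolution.exteriorProfile_le (hn : 3 ≤ finrank ℝ E) {Ω : Set E} (hΩ : IsOpen Ω)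
    {u : E → ℝ} (hu : IsLargeSolution Ω u) {c : E} {R : ℝ} (hR : 0 < R)
    (hsub : closure Ω ⊆ (closedBall c R)ᶜ) : ∀ x ∈ Ω, exteriorProfile c R x ≤ u x := by
  have hv : IsSolution Ω (exteriorProfile c R) :=
    (isSolution_exteriorProfile c hR).mono (subset_closure.trans hsub)
  refine hv.le_of_isCompact_superlevel hn hΩ hu.toIsSolution fun s hs => ?_
  refine Metric.isCompact_of_isClosed_isBounded ?_ ?_
  · refine isClosed_superlevel_of_tendsto_atBot hΩ
      (hv.contDiffOn.continuousOn.sub hu.contDiffOn.continuousOn) (fun z hz => ?_) s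
    -- at a boundary point: the exterior profile is continuous, `u → +∞`
    have hz' : z ∈ (closedBall c R)ᶜ := hsub (frontier_subset_closure hz)
    have h1 : Tendsto (exteriorProfile c R) (𝓝[Ω] z) (𝓝 (exteriorProfile c R z)) :=
      (((contDiffOn_exteriorProfile c hR).continuousOn.continuousAt
        (isClosed_closedBall.isOpen_compl.mem_nhds hz')).tendsto).mono_left nhdsWithin_le_nhds
    have h2 : Tendsto (fun x => -u x) (𝓝[Ω] z) atBot :=
      tendsto_neg_atTop_atBot.comp (hu.tendsto_atTop hz)
    exact (h1.add_atBot h2).congr fun y => (sub_eq_add_neg (exteriorProfile c R y) (u y)).symm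
  · refine (isBounded_superlevel_exteriorProfile hn c R hs).subset fun x hx => ?_
    have h0 : 0 ≤ u x := hu.nonneg hx.1
    have h := hx.2
    show s ≤ exteriorProfile c R x
    linarith

/-! ### The Liouville theorem on the half-space -/

/-- The common limit of the two barriers: `(2R/(a(2R+b)))^k → (a⁻¹)^k` as `R → ∞`, `a > 0`.
[folklore] -/
theorem tendsto_barrier_atTop {a : ℝ} (ha : 0 < a) (b k : ℝ) :
    Tendsto (fun R : ℝ => (2 * R / (a * (2 * R + b))) ^ k) atTop (𝓝 (a⁻¹ ^ k)) := by
  have h1 : Tendsto (fun R : ℝ => 2 * R + b) atTop atTop :=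
    tendsto_atTop_add_const_right _ b (tendsto_id.const_mul_atTop two_pos)
  have h2 : Tendsto (fun R : ℝ => b / (2 * R + b)) atTop (𝓝 0) := tendsto_const_nhds.div_atTop h1
  have h3 : Tendsto (fun R : ℝ => 1 - b / (2 * R + b)) atTop (𝓝 (1 - 0)) :=
    tendsto_const_nhds.sub h2
  rw [sub_zero] at h3
  have h4 : Tendsto (fun R : ℝ => 2 * R / (a * (2 * R + b))) atTop (𝓝 (a⁻¹ * 1)) := by
    refine (h3.const_mul a⁻¹).congr' ?_
    filter_upwards [h1.eventually (eventually_gt_atTop 0)] with R hR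
    have hne : 2 * R + b ≠ 0 := hR.ne'
    field_simp
    ring
  rw [mul_one] at h4
  exact h4.rpow_const (Or.inl (inv_ne_zero ha.ne'))

omit [FiniteDimensional ℝ E] in
/-- Cauchy–Schwarz against a unit vector: `-‖y‖ ≤ ⟪y, ν⟫ ≤ ‖y‖`. [folklore] -/
theorem abs_inner_le_norm_of_norm_eq_one (y : E) {ν : E} (hν : ‖ν‖ = 1) : |⟪y, ν⟫_ℝ| ≤ ‖y‖ := by
  simpa [hν] using abs_real_inner_le_norm y ν

/-- **The Liouville theorem on the half-space** (Duncan–Nguyen 2025, Cor. 1.4, "previously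
observed in [HS20]"): for `n ≥ 3` and `‖ν‖ = 1`, every classical solution of
`Δu = ¼n(n-2)u^{(n+2)/(n-2)}` on `H(p,ν)` tending to `+∞` at every point of `∂H` equals
`⟪x - p, ν⟫^{-(n-2)/2}` — with no assumption at infinity. Proof: for `x ∈ H`, `t = ⟪x-p,ν⟫`,
`0 < a < t < R`, the ball `B(x + (R-a)ν, R) ⋐ H` gives `u(x) ≤ (2R/(a(2R-a)))^k`
(`IsSolution.le_ballProfile`); for `a > t`, `R > 0`, the ball `B(x - (a+R)ν, R)`, whose closure
misses `cl H`, gives `(2R/(a(2R+a)))^k ≤ u(x)` (`IsLargeSolution.exteriorProfile_le`); let `R → ∞`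
and then `a → t`. [cite: DuncanNguyen2025, Cor. 1.4] -/
theorem IsLargeSolution.eqOn_halfSpaceProfile (hn : 3 ≤ finrank ℝ E) (p : E) {ν : E}
    (hν : ‖ν‖ = 1) {u : E → ℝ} (hu : IsLargeSolution (halfSpace p ν) u) :
    EqOn u (halfSpaceProfile p ν) (halfSpace p ν) := by
  intro x hx
  obtain ⟨k, hk⟩ : ∃ k : ℝ, ((finrank ℝ E : ℝ) - 2) / 2 = k := ⟨_, rfl⟩
  set t : ℝ := ⟪x - p, ν⟫_ℝ with ht_def
  have ht : 0 < t := hx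
  have hνν : ⟪ν, ν⟫_ℝ = 1 := by rw [real_inner_self_eq_norm_sq, hν, one_pow]
  have hHopen : IsOpen (halfSpace p ν) := isOpen_halfSpace p ν
  -- UPPER BOUND `u x ≤ (2R/(a(2R-a)))^k` for `0 < a < t < R`, from the ball `B(x + (R-a)ν, R)`
  have hup : ∀ a, 0 < a → a < t → ∀ R, t < R → u x ≤ (2 * R / (a * (2 * R + -a))) ^ k := by
    intro a ha hat R hR
    have hR0 : 0 < R := ht.trans hR
    set ρ : ℝ := R - a with hρ
    have hρ0 : 0 < ρ := by rw [hρ]; linarith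
    set c : E := x + ρ • ν with hc
    have hcp : ⟪c - p, ν⟫_ℝ = t + ρ := by
      rw [hc, show x + ρ • ν - p = (x - p) + ρ • ν by abel, inner_add_left,
        real_inner_smul_left, hνν, mul_one]
    have hsub : closedBall c R ⊆ halfSpace p ν := by
      intro y hy
      rw [mem_closedBall, dist_eq_norm] at hy
      have h1 : ⟪y - p, ν⟫_ℝ = ⟪y - c, ν⟫_ℝ + (t + ρ) := by
        rw [← hcp, ← inner_add_left]
        congr 1
        abel
      have h2 : -‖y - c‖ ≤ ⟪y - c, ν⟫_ℝ :=
        neg_le_of_abs_le (abs_inner_le_norm_of_norm_eq_one (y - c) hν)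
      show 0 < ⟪y - p, ν⟫_ℝ
      rw [h1, hρ]
      linarith
    have hxc : ‖x - c‖ = ρ := by
      rw [hc, sub_add_cancel_left, norm_neg, norm_smul, hν, mul_one, Real.norm_of_nonneg hρ0.le]
    have hxball : x ∈ ball c R := by
      rw [mem_ball, dist_eq_norm, hxc, hρ]
      linarith
    have hle := hu.toIsSolution.le_ballProfile hn hHopen hR0 hsub hxball
    have hden : R ^ 2 - ρ ^ 2 = a * (2 * R + -a) := by rw [hρ]; ring
    rw [ballProfile, hxc, hden, hk] at hle
    exact hle
  -- LOWER BOUND `(2R/(a(2R+a)))^k ≤ u x` for `t < a`, `0 < R`, from the ball `B(x - (a+R)ν, R)`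
  have hlow : ∀ a, t < a → ∀ R, 0 < R → (2 * R / (a * (2 * R + a))) ^ k ≤ u x := by
    intro a hat R hR0
    set c : E := x - (a + R) • ν with hc
    have hcp : ⟪c - p, ν⟫_ℝ = t - (a + R) := by
      rw [hc, show x - (a + R) • ν - p = (x - p) - (a + R) • ν by abel, inner_sub_left,
        real_inner_smul_left, hνν, mul_one]
    have hsub : closure (halfSpace p ν) ⊆ (closedBall c R)ᶜ := by
      intro y hy
      have hy0 : 0 ≤ ⟪y - p, ν⟫_ℝ :=
        closure_lt_subset_le (f := fun _ : E => (0 : ℝ)) (g := fun z : E => ⟪z - p, ν⟫_ℝ)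
          continuous_const (by fun_prop) hy
      have h1 : ⟪y - c, ν⟫_ℝ = ⟪y - p, ν⟫_ℝ - (t - (a + R)) := by
        rw [← hcp, ← inner_sub_left]
        congr 1
        abel
      have h2 : ⟪y - c, ν⟫_ℝ ≤ ‖y - c‖ :=
        le_of_abs_le (abs_inner_le_norm_of_norm_eq_one (y - c) hν)
      rw [mem_compl_iff, mem_closedBall, dist_eq_norm, not_le]
      linarith
    have hxc : ‖x - c‖ = a + R := by
      have ha0 : 0 ≤ a + R := by linarith
      rw [hc, sub_sub_cancel, norm_smul, hν, mul_one, Real.norm_of_nonneg ha0]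
    have hle := hu.exteriorProfile_le hn hHopen hR0 hsub x hx
    have hden : (a + R) ^ 2 - R ^ 2 = a * (2 * R + a) := by ring
    rw [exteriorProfile, hxc, hden, hk] at hle
    exact hle
  -- let `R → ∞`: `u x ≤ a⁻¹ ^ k` for `0 < a < t` and `a⁻¹ ^ k ≤ u x` for `t < a`
  have hup' : ∀ a, 0 < a → a < t → u x ≤ a⁻¹ ^ k := fun a ha hat =>
    ge_of_tendsto (tendsto_barrier_atTop ha (-a) k)
      ((eventually_gt_atTop t).mono fun R hR => hup a ha hat R hR)
  have hlow' : ∀ a, t < a → a⁻¹ ^ k ≤ u x := fun a hat =>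
    le_of_tendsto (tendsto_barrier_atTop (ht.trans hat) a k)
      ((eventually_gt_atTop 0).mono fun R hR => hlow a hat R hR)
  -- let `a → t`
  have hcont : Tendsto (fun a : ℝ => a⁻¹ ^ k) (𝓝 t) (𝓝 (t⁻¹ ^ k)) :=
    (tendsto_inv₀ ht.ne').rpow_const (Or.inl (inv_ne_zero ht.ne'))
  have h1 : u x ≤ t⁻¹ ^ k := by
    refine ge_of_tendsto (hcont.mono_left (nhdsWithin_le_nhds (s := Iio t))) ?_
    filter_upwards [Ioo_mem_nhdsLT ht] with a ha using hup' a ha.1 ha.2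
  have h2 : t⁻¹ ^ k ≤ u x := by
    refine le_of_tendsto (hcont.mono_left (nhdsWithin_le_nhds (s := Ioi t))) ?_
    filter_upwards [self_mem_nhdsWithin] with a ha using hlow' a ha
  have hval : halfSpaceProfile p ν x = t⁻¹ ^ k := by
    rw [halfSpaceProfile, hk, ← ht_def, Real.rpow_neg ht.le, Real.inv_rpow ht.le]
  rw [hval]
  exact le_antisymm h1 h2

/-- **F5 discharged**: the named fact `halfSpace_unique` (Duncan–Nguyen 2025, Cor. 1.4) holds —
the half-space profile is a positive large solution of `H(p,ν)` and every positive large solution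
coincides with it on `H(p,ν)`. [cite: DuncanNguyen2025, Cor. 1.4] -/
theorem halfSpace_unique_holds : halfSpace_unique (E := E) := by
  intro p ν hn hν
  exact ⟨⟨isLargeSolution_halfSpaceProfile hn p hν, fun x hx => halfSpaceProfile_pos hx⟩,
    fun u hu _ => hu.eqOn_halfSpaceProfile hn p hν⟩

end LoewnerNirenberg

end Literature.Analysis.PDE
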